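import Literature.Probability.Percolation.SlabRSWProp39Iter
import Literature.Probability.Percolation.BernoulliPercolation
import HarnessLib

/-!
# Newman–Tassion–Wu 2017, §3.5 — the closing step of Theorem 3.14: from `f(28n,14n) ≥ c` for all
# large `n` to `inf_{m ≥ 1} f(2m, m) > 0`

Topic: `Literature/Probability/Percolation`. The end of the proof of NTW's RSW Theorem 3.14
(arXiv:1512.09107 p. 17: "Combining the three cases above, we have `inf_n f(28n,14n) ≥ c₉` …
which (by another use of Proposition 3.9) yields the conclusion of Theorem 3.14"), made explicit
in the slab `S_k` and for `0 < p < 1`: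

* `pow_le_real_lr` — **crossing probabilities are positive**: `p^w ≤ f_p(w,h)` (open the straight
  segment `{0,…,w} × {0} × {0}`); this handles the finitely many small `m`;
* `real_lr_42_ge` — one step of Prop. 3.9 (1) (`prop39_one_step` of p2 GEN 39, linear regime):
  `((1-√(1-f(28n,14n))) f(28n,14n))² ≤ K₁²K₂ · f(42n,14n)`;
* `real_lr_two_one_ge_of_42` — for `14n ≤ m ≤ 21n`: `f(42n, 14n) ≤ f(2m, m)` (wider is harder,
  taller is easier);
* **`hardWay_of_f28_14`** — if `c ≤ f_p(28n,14n)` for every `n ≥ n₀` (`n₀ ≥ ρ`, `ρ ≥ 4`,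
  `0 < c`), then for EVERY `m ≥ 1`,
  `min (((1-√(1-c)) c)² / (K₁²K₂)) (p^{28 max(n₀,2)}) ≤ f_p(2m, m)` — the conclusion
  `inf_{m≥1} f(2m,m) > 0` of Theorem 3.14 with an explicit constant.

## Sources

* C. M. Newman, V. Tassion, W. Wu, *Critical percolation and the minimal spanning tree in slabs*,
  Comm. Pure Appl. Math. 70 (2017) 2084–2120, arXiv:1512.09107: §3.5, end of the proof of
  Theorem 3.14 ((3.54) and "another use of Proposition 3.9"); Prop. 3.9 (1) [NewmanTassionWu2017].
-/

noncomputable section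

namespace Literature.Probability.Percolation

open MeasureTheory LatticeModels SimpleGraph

namespace NTW17

variable {k : ℕ}

/-! ## §1 Crossing probabilities are positive -/

/-- **`p^w ≤ f_p(w, h)`**: the straight segment `(i, 0)`, `i = 0, …, w`, at height `0` is an open
left-right crossing of `[0,w] × [0,h]` as soon as its `w` edges are open.
[cite: NewmanTassionWu2017, §3.3 (f(m,n) > 0 for p > 0, implicit)] -/
theorem pow_le_real_lr (w h : ℕ) (p : unitInterval) :
    (p : ℝ) ^ w ≤ (bondPercolation (slabGraph 3 k) p).real
      (slabConn k (boxR 0 w 0 h) {z | z.1 = 0} {z | z.1 = (w : ℤ)}) := by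
  classical
  set P := bondPercolation (slabGraph 3 k) p with hP
  -- the vertices and edges of the segment
  let v : ℕ → slab 3 k := fun i => vtx k ((i : ℤ), 0) 0
  have hadj : ∀ i : ℕ, (slabGraph 3 k).Adj (v i) (v (i + 1)) := by
    intro i
    refine vtx_adj_vtx_planar ?_ 0
    left; left
    simp only [Prod.mk_add_mk, add_zero, Prod.mk.injEq]
    push_cast
    exact ⟨rfl, trivial⟩
  set F : Finset (Sym2 (slab 3 k)) := (Finset.range w).image fun i => s(v i, v (i + 1)) with hF
  have hFE : (F : Set (Sym2 (slab 3 k))) ⊆ (slabGraph 3 k).edgeSet := by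
    intro e he
    rw [Finset.mem_coe, hF, Finset.mem_image] at he
    obtain ⟨i, -, rfl⟩ := he
    exact (SimpleGraph.mem_edgeSet _).2 (hadj i)
  have hcard : F.card ≤ w := by
    rw [hF]; exact Finset.card_image_le.trans (by simp)
  have hprob : P.real {ω | (F : Set (Sym2 (slab 3 k))) ⊆ ω} = (p : ℝ) ^ F.card :=
    bondPercolation_real_setOf_subset _ p F hFE
  -- all edges open ⇒ crossing
  have hsub : {ω : BondConfig (slab 3 k) | (F : Set (Sym2 (slab 3 k))) ⊆ ω} ⊆
      slabConn k (boxR 0 w 0 h) {z | z.1 = 0} {z | z.1 = (w : ℤ)} := by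
    intro ω hω
    have hvS : ∀ i : ℕ, i ≤ w → v i ∈ slabLift k (boxR 0 w 0 h) := by
      intro i hi
      rw [mem_slabLift_iff, planar_vtx, mem_boxR_iff]
      simp only
      exact ⟨by positivity, by exact_mod_cast hi, le_rfl, by positivity⟩
    have hconn : ∀ i : ℕ, i ≤ w → ω ∈ openConnIn (slabLift k (boxR 0 w 0 h)) (v 0) (v i) := by
      intro i
      induction i with
      | zero => intro _; exact openConnIn_refl (hvS 0 (Nat.zero_le _))
      | succ i ih =>
        intro hi
        have h1 := ih (by omega)
        have he : s(v i, v (i + 1)) ∈ ω := hω (by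
          rw [Finset.mem_coe, hF, Finset.mem_image]; exact ⟨i, Finset.mem_range.2 (by omega), rfl⟩)
        exact SlabCriticality.openConnIn_trans h1
          (openConnIn_of_adj (hvS i (by omega)) (hvS (i + 1) hi) he (hadj i).ne)
    refine ⟨v 0, by rw [mem_slabLift_iff, planar_vtx]; simp, v w, by
      rw [mem_slabLift_iff, planar_vtx]; rfl, hconn w le_rfl⟩
  calc (p : ℝ) ^ w ≤ (p : ℝ) ^ F.card := pow_le_pow_of_le_one p.2.1 p.2.2 hcard
    _ = P.real {ω | (F : Set (Sym2 (slab 3 k))) ⊆ ω} := hprob.symm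
    _ ≤ _ := measureReal_mono hsub (measure_ne_top _ _)

/-! ## §2 One stretch by Proposition 3.9 (1), and monotonicity -/

/-- **`f(42n, 14n)` from `f(28n, 14n)`** (one step of Prop. 3.9 (1), `κ = 1`, `j = 2`, linear
regime): `((1 - √(1 - f(28n,14n))) · f(28n,14n))² ≤ K₁² K₂ · f(42n, 14n)` for `n ≥ ρ ≥ 4`.
[cite: NewmanTassionWu2017, §3.3 (Proposition 3.9 (1)) and §3.5 ("another use of Proposition 3.9")] -/
theorem real_lr_42_ge (hk : 1 ≤ k) {ρ : ℕ} (hρ : 4 ≤ ρ) {n : ℕ} (hn : ρ ≤ n)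
    (p : unitInterval) (hp0 : 0 < (p : ℝ)) (hp1 : (p : ℝ) < 1) :
    ((1 - Real.sqrt (1 - (bondPercolation (slabGraph 3 k) p).real
        (slabConn k (boxR 0 (28 * n) 0 (14 * n)) {z | z.1 = 0} {z | z.1 = 28 * n}))) *
        (bondPercolation (slabGraph 3 k) p).real
          (slabConn k (boxR 0 (28 * n) 0 (14 * n)) {z | z.1 = 0} {z | z.1 = 28 * n})) ^ 2 ≤
      (1 + (2 / min (p : ℝ) (1 - p)) ^ (3 * ((5 * k + 4) * (2 * (6 * ρ + 4) + 1) ^ 2))) ^ 2 *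
        (1 + (2 / min (p : ℝ) (1 - p)) ^ (3 * ((5 * k + 4) * (2 * (2 * (3 * ρ + 3)) + 1) ^ 2))) *
        (bondPercolation (slabGraph 3 k) p).real
          (slabConn k (boxR 0 (42 * n) 0 (14 * n)) {z | z.1 = 0} {z | z.1 = 42 * n}) := by
  have hρn : (ρ : ℤ) ≤ n := by exact_mod_cast hn
  have hρ4 : (4 : ℤ) ≤ ρ := by exact_mod_cast hρ
  have h := prop39_one_step (k := k) hk hρ (n := 14 * n) (m := 14 * n) (h := 7 * n) (by linarith)
    (by linarith) (by linarith) (by positivity) (by linarith) p hp0 hp1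
  rw [show (14 : ℤ) * n + 14 * n = 28 * n by ring] at h
  have hsh := real_lr_shift (k := k) ((-(14 * (n : ℤ))), (0 : ℤ)) 0 (42 * n) 0 (14 * n) p
  dsimp only at hsh
  rw [show (0 : ℤ) + -(14 * (n : ℤ)) = -(14 * n) by ring,
    show (42 : ℤ) * n + -(14 * (n : ℤ)) = 28 * n by ring] at hsh
  simp only [add_zero] at hsh
  rw [hsh] at h
  exact h

/-- **`f(42n, 14n) ≤ f(2m, m)` for `14n ≤ m ≤ 21n`** (a wider rectangle is harder to cross, a
taller one easier). [cite: NewmanTassionWu2017, §3.3 ((3.8)) and §3.5 (end of the proof of Theorem 3.14)] -/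
theorem real_lr_two_one_ge_of_42 {n m : ℕ} (h1 : 14 * n ≤ m) (h2 : m ≤ 21 * n) (p : unitInterval) :
    (bondPercolation (slabGraph 3 k) p).real
        (slabConn k (boxR 0 (42 * n) 0 (14 * n)) {z | z.1 = 0} {z | z.1 = 42 * n}) ≤
      (bondPercolation (slabGraph 3 k) p).real
        (slabConn k (boxR 0 (2 * m) 0 m) {z | z.1 = 0} {z | z.1 = 2 * m}) := by
  have h1' : (14 : ℤ) * n ≤ m := by exact_mod_cast h1
  have h2' : (m : ℤ) ≤ 21 * n := by exact_mod_cast h2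
  calc (bondPercolation (slabGraph 3 k) p).real
        (slabConn k (boxR 0 (42 * n) 0 (14 * n)) {z | z.1 = 0} {z | z.1 = 42 * n})
      ≤ (bondPercolation (slabGraph 3 k) p).real
          (slabConn k (boxR 0 (2 * m) 0 (14 * n)) {z | z.1 = 0} {z | z.1 = 2 * m}) :=
        real_lr_wider_le (k := k) (a := 0) (b := 2 * m) (b' := 42 * n) (c := 0) (d := 14 * n)
          (by positivity) (by linarith) p
    _ ≤ _ := real_lr_le_taller (k := k) (a := 0) (b := 2 * m) (c := 0) (d := 14 * n) (c' := 0) (d' := m)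
          le_rfl h1' p

/-! ## §3 The conclusion of Theorem 3.14 -/

/-- **NTW 2017, end of the proof of Theorem 3.14** (explicit form).  Slab `S_k` (`k ≥ 1`),
`ρ ≥ 4`, `0 < p < 1`.  If `c ≤ f_p(28n, 14n)` for every `n ≥ n₀` (with `n₀ ≥ ρ` and `0 < c`), then
for EVERY `m ≥ 1`:  `min (((1-√(1-c))·c)²/(K₁²K₂)) (p^{28·max(n₀,2)}) ≤ f_p(2m, m)` — in particular
`inf_{m ≥ 1} f_p(2m, m) > 0`.  (`K₁ = 1+λ^{3(5k+4)(12ρ+9)²}`, `K₂ = 1+λ^{3(5k+4)(12ρ+13)²}`,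
`λ = 2/min(p,1-p)`.)  For `m ≥ 14·max(n₀,2)`: `n = ⌊m/14⌋` has `14n ≤ m ≤ 21n`, so
`f(2m,m) ≥ f(42n,14n) ≥ ((1-√(1-c))c)²/(K₁²K₂)`; smaller `m` by `pow_le_real_lr`.
[cite: NewmanTassionWu2017, Theorem 3.14 (end of proof, (3.54))] -/
theorem hardWay_of_f28_14 (hk : 1 ≤ k) {ρ : ℕ} (hρ : 4 ≤ ρ) (p : unitInterval) (hp0 : 0 < (p : ℝ))
    (hp1 : (p : ℝ) < 1) {c : ℝ} (hc : 0 < c) {n₀ : ℕ} (hn₀ : ρ ≤ n₀)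
    (h : ∀ n : ℕ, n₀ ≤ n → c ≤ (bondPercolation (slabGraph 3 k) p).real
      (slabConn k (boxR 0 (28 * n) 0 (14 * n)) {z | z.1 = 0} {z | z.1 = 28 * n})) :
    ∀ m : ℕ, 1 ≤ m →
      min (((1 - Real.sqrt (1 - c)) * c) ^ 2 /
          ((1 + (2 / min (p : ℝ) (1 - p)) ^ (3 * ((5 * k + 4) * (2 * (6 * ρ + 4) + 1) ^ 2))) ^ 2 *
            (1 + (2 / min (p : ℝ) (1 - p)) ^ (3 * ((5 * k + 4) * (2 * (2 * (3 * ρ + 3)) + 1) ^ 2)))))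
        ((p : ℝ) ^ (28 * max n₀ 2)) ≤
      (bondPercolation (slabGraph 3 k) p).real (slabConn k (boxR 0 (2 * m) 0 m) {z | z.1 = 0} {z | z.1 = 2 * m}) := by
  set P := bondPercolation (slabGraph 3 k) p with hP
  set K : ℝ := (1 + (2 / min (p : ℝ) (1 - p)) ^ (3 * ((5 * k + 4) * (2 * (6 * ρ + 4) + 1) ^ 2))) ^ 2 *
      (1 + (2 / min (p : ℝ) (1 - p)) ^ (3 * ((5 * k + 4) * (2 * (2 * (3 * ρ + 3)) + 1) ^ 2))) with hK
  have hKpos : 0 < K := by positivity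
  clear_value K
  intro m hm
  set N := max n₀ 2 with hN
  by_cases hsmall : m < 14 * N
  · -- small `m`: the straight segment
    refine (min_le_right _ _).trans ?_
    have h1 := pow_le_real_lr (k := k) (2 * m) m p
    push_cast at h1
    refine le_trans ?_ h1
    exact pow_le_pow_of_le_one p.2.1 p.2.2 (by omega)
  · -- large `m`: `n = ⌊m/14⌋`
    push Not at hsmall
    refine (min_le_left _ _).trans ?_
    set n := m / 14 with hn
    have hn14 : 14 * n ≤ m := Nat.mul_div_le m 14
    have hm21 : m ≤ 21 * n := by omega
    have hnN : N ≤ n := by omega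
    have hn₀n : n₀ ≤ n := le_trans (le_max_left _ _) hnN
    have hρn : ρ ≤ n := hn₀.trans hn₀n
    have hc' := h n hn₀n
    have hstep := real_lr_42_ge hk hρ hρn p hp0 hp1
    rw [← hK] at hstep
    have hmono := real_lr_two_one_ge_of_42 (k := k) hn14 hm21 p
    -- `((1-√(1-c)) c)² ≤ ((1-√(1-f)) f)²` for `c ≤ f ≤ 1`
    set f := P.real (slabConn k (boxR 0 (28 * n) 0 (14 * n)) {z : ℤ × ℤ | z.1 = 0} {z | z.1 = 28 * n}) with hf
    have hf1 : f ≤ 1 := measureReal_le_one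
    have hc1 : c ≤ 1 := hc'.trans hf1
    have hsq : 1 - Real.sqrt (1 - c) ≤ 1 - Real.sqrt (1 - f) := by
      have := Real.sqrt_le_sqrt (show 1 - f ≤ 1 - c by linarith)
      linarith
    have hs0 : 0 ≤ 1 - Real.sqrt (1 - c) := by
      have h1 : Real.sqrt (1 - c) ≤ Real.sqrt 1 := Real.sqrt_le_sqrt (by linarith)
      rw [Real.sqrt_one] at h1
      linarith
    have hprod : (1 - Real.sqrt (1 - c)) * c ≤ (1 - Real.sqrt (1 - f)) * f :=
      mul_le_mul hsq hc' hc.le (hs0.trans hsq)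
    have hsq2 : ((1 - Real.sqrt (1 - c)) * c) ^ 2 ≤ ((1 - Real.sqrt (1 - f)) * f) ^ 2 :=
      pow_le_pow_left₀ (mul_nonneg hs0 hc.le) hprod 2
    rw [div_le_iff₀ hKpos]
    calc ((1 - Real.sqrt (1 - c)) * c) ^ 2 ≤ ((1 - Real.sqrt (1 - f)) * f) ^ 2 := hsq2
      _ ≤ K * P.real (slabConn k (boxR 0 (42 * n) 0 (14 * n)) {z | z.1 = 0} {z | z.1 = 42 * n}) := hstep
      _ ≤ K * P.real (slabConn k (boxR 0 (2 * m) 0 m) {z | z.1 = 0} {z | z.1 = 2 * m}) :=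
          mul_le_mul_of_nonneg_left hmono hKpos.le
      _ = _ := by ring

/-! ## §4 General forms: iterating Proposition 3.9 (1) from `f(N+M, N)`, and the closing step from `f(2Ln, Ln)` -/

/-- **Iterating Prop. 3.9 (1) at a fixed height** (linear regime): there is a positive non-increasing
sequence `a` with `a_0 = c` (`a_{i+1} = φ(a_i)`, `φ(x) = ((1-√(1-x))x)²/(K₁²K₂)`) such that for every
height `N > 8ρ+16`, every step `M ≥ 1` and every `j`: `c ≤ f_p(N+M, N)` implies
`a_j ≤ f_p(N+(j+1)M, N)`.  (Case 3 of Thm 3.14 ends with `f(14n,13n) ≥ c₇`: take `N = 13n`, `M = n`,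
`j = 12` to reach `f(26n,13n)`, then `hardWay_of_f2L_L` with `L = 13`.)
[cite: NewmanTassionWu2017, §3.3 (Proposition 3.9 (1)) and §3.5 (Case 3: "by Item 1 of Proposition 3.9 we obtain f(28n,13n) ≥ c₈")] -/
theorem real_lr_item1_iter (hk : 1 ≤ k) {ρ : ℕ} (hρ : 4 ≤ ρ) (p : unitInterval) (hp0 : 0 < (p : ℝ))
    (hp1 : (p : ℝ) < 1) {c : ℝ} (hc0 : 0 < c) (hc1 : c ≤ 1) :
    ∃ a : ℕ → ℝ, (∀ i, 0 < a i) ∧ (∀ i, a i ≤ 1) ∧ (∀ i, a (i + 1) ≤ a i) ∧ a 0 = c ∧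
      ∀ N M : ℕ, 8 * ρ + 16 < N → 1 ≤ M → ∀ j : ℕ,
        c ≤ (bondPercolation (slabGraph 3 k) p).real
          (slabConn k (boxR 0 (N + M) 0 N) {z | z.1 = 0} {z | z.1 = N + M}) →
        a j ≤ (bondPercolation (slabGraph 3 k) p).real
          (slabConn k (boxR 0 (N + (j + 1) * M) 0 N) {z | z.1 = 0} {z | z.1 = N + (j + 1) * M}) := by
  set P := bondPercolation (slabGraph 3 k) p with hP
  set K : ℝ := (1 + (2 / min (p : ℝ) (1 - p)) ^ (3 * ((5 * k + 4) * (2 * (6 * ρ + 4) + 1) ^ 2))) ^ 2 *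
      (1 + (2 / min (p : ℝ) (1 - p)) ^ (3 * ((5 * k + 4) * (2 * (2 * (3 * ρ + 3)) + 1) ^ 2))) with hK
  have hK1 : 1 ≤ K := by
    have h1 : (1 : ℝ) ≤ 1 + (2 / min (p : ℝ) (1 - p)) ^ (3 * ((5 * k + 4) * (2 * (6 * ρ + 4) + 1) ^ 2)) :=
      le_add_of_nonneg_right (by positivity)
    have h2 : (1 : ℝ) ≤ 1 + (2 / min (p : ℝ) (1 - p)) ^ (3 * ((5 * k + 4) * (2 * (2 * (3 * ρ + 3)) + 1) ^ 2)) :=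
      le_add_of_nonneg_right (by positivity)
    rw [hK]; exact one_le_mul_of_one_le_of_one_le (one_le_pow₀ h1) h2
  have hKpos : 0 < K := lt_of_lt_of_le one_pos hK1
  clear_value K
  let φ : ℝ → ℝ := fun x => ((1 - Real.sqrt (1 - x)) * x) ^ 2 / K
  -- `φ` is increasing and `0 < φ x ≤ x` on `(0,1]`
  have phi_mono' : ∀ {x y : ℝ}, 0 ≤ x → x ≤ y → φ x ≤ φ y := by
    intro x y hx hxy
    have hsq : 1 - Real.sqrt (1 - x) ≤ 1 - Real.sqrt (1 - y) := by
      have := Real.sqrt_le_sqrt (show 1 - y ≤ 1 - x by linarith); linarith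
    have hs0 : 0 ≤ 1 - Real.sqrt (1 - x) := by
      have h1 : Real.sqrt (1 - x) ≤ Real.sqrt 1 := Real.sqrt_le_sqrt (by linarith)
      rw [Real.sqrt_one] at h1; linarith
    have hprod : (1 - Real.sqrt (1 - x)) * x ≤ (1 - Real.sqrt (1 - y)) * y :=
      mul_le_mul hsq hxy hx (hs0.trans hsq)
    exact div_le_div_of_nonneg_right (pow_le_pow_left₀ (mul_nonneg hs0 hx) hprod 2) hKpos.le
  have phi_pos_le' : ∀ {x : ℝ}, 0 < x → x ≤ 1 → 0 < φ x ∧ φ x ≤ x := by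
    intro x hx hx1
    have hs1 : Real.sqrt (1 - x) < 1 := by
      have h1 : Real.sqrt (1 - x) < Real.sqrt 1 := Real.sqrt_lt_sqrt (by linarith) (by linarith)
      rwa [Real.sqrt_one] at h1
    have hs0 : 0 < 1 - Real.sqrt (1 - x) := by linarith
    have hsle : 1 - Real.sqrt (1 - x) ≤ 1 := by linarith [Real.sqrt_nonneg (1 - x)]
    refine ⟨by positivity, ?_⟩
    show ((1 - Real.sqrt (1 - x)) * x) ^ 2 / K ≤ x
    rw [div_le_iff₀ hKpos]
    have h1 : (1 - Real.sqrt (1 - x)) * x ≤ x := by nlinarith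
    have h2 : ((1 - Real.sqrt (1 - x)) * x) ^ 2 ≤ x ^ 2 := pow_le_pow_left₀ (by positivity) h1 2
    nlinarith
  let a : ℕ → ℝ := fun i => φ^[i] c
  have ha_succ : ∀ i, a (i + 1) = φ (a i) := fun i => Function.iterate_succ_apply' φ i c
  have ha01 : ∀ i, 0 < a i ∧ a i ≤ 1 := by
    intro i
    induction i with
    | zero => exact ⟨hc0, hc1⟩
    | succ i ih =>
      rw [ha_succ]
      have := phi_pos_le' ih.1 ih.2
      exact ⟨this.1, this.2.trans ih.2⟩
  refine ⟨a, fun i => (ha01 i).1, fun i => (ha01 i).2, fun i => ?_, rfl, fun N M hN hM j hF => ?_⟩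
  · rw [ha_succ]; exact (phi_pos_le' (ha01 i).1 (ha01 i).2).2
  · induction j with
    | zero =>
      show φ^[0] c ≤ _
      rw [Function.iterate_zero_apply]
      simpa using hF
    | succ j ih =>
      have hN0 : (0 : ℤ) ≤ N := by positivity
      have hM0 : (0 : ℤ) ≤ M := by positivity
      have hρN : (8 : ℤ) * ρ + 16 < N := by exact_mod_cast hN
      have hdiv : (N : ℤ) / 2 ≤ N := Int.ediv_le_self 2 hN0
      have hjM : (M : ℤ) ≤ ((j + 1 : ℕ) : ℤ) * M := by
        have : (1 : ℤ) * M ≤ ((j + 1 : ℕ) : ℤ) * M :=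
          mul_le_mul_of_nonneg_right (by exact_mod_cast Nat.succ_le_succ (Nat.zero_le j)) hM0
        simpa using this
      have hstep := prop39_item1 (k := k) hk hρ (n := N) (m := M) (h := N / 2) (j := j + 1) (by omega)
        (by omega) (by omega) (by omega) hM0 (by omega) p hp0 hp1
      rw [← hK] at hstep
      set F := P.real (slabConn k (boxR 0 (N + ((j + 1 : ℕ) : ℤ) * M) 0 N) {z : ℤ × ℤ | z.1 = 0}
        {z | z.1 = N + ((j + 1 : ℕ) : ℤ) * M}) with hFdef
      rw [ha_succ]
      calc φ (a j) ≤ φ F := phi_mono' (ha01 j).1.le ih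
        _ ≤ _ := by
          show ((1 - Real.sqrt (1 - F)) * F) ^ 2 / K ≤ _
          rw [div_le_iff₀ hKpos]
          linarith [hstep]

/-- **`f(3Ln, Ln)` from `f(2Ln, Ln)`** (one step of Prop. 3.9 (1), linear regime), `Ln > 8ρ + 16`.
[cite: NewmanTassionWu2017, §3.3 (Proposition 3.9 (1)) and §3.5 ("another use of Proposition 3.9")] -/
theorem real_lr_3L_ge (hk : 1 ≤ k) {ρ : ℕ} (hρ : 4 ≤ ρ) {L n : ℕ} (hn : 8 * ρ + 16 < L * n)
    (p : unitInterval) (hp0 : 0 < (p : ℝ)) (hp1 : (p : ℝ) < 1) :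
    ((1 - Real.sqrt (1 - (bondPercolation (slabGraph 3 k) p).real
        (slabConn k (boxR 0 (2 * (L * n)) 0 (L * n)) {z | z.1 = 0} {z | z.1 = 2 * (L * n)}))) *
        (bondPercolation (slabGraph 3 k) p).real
          (slabConn k (boxR 0 (2 * (L * n)) 0 (L * n)) {z | z.1 = 0} {z | z.1 = 2 * (L * n)})) ^ 2 ≤
      (1 + (2 / min (p : ℝ) (1 - p)) ^ (3 * ((5 * k + 4) * (2 * (6 * ρ + 4) + 1) ^ 2))) ^ 2 *
        (1 + (2 / min (p : ℝ) (1 - p)) ^ (3 * ((5 * k + 4) * (2 * (2 * (3 * ρ + 3)) + 1) ^ 2))) *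
        (bondPercolation (slabGraph 3 k) p).real
          (slabConn k (boxR 0 (3 * (L * n)) 0 (L * n)) {z | z.1 = 0} {z | z.1 = 3 * (L * n)}) := by
  set N : ℕ := L * n with hN
  have hN0 : (0 : ℤ) ≤ N := by positivity
  have hρN : (8 : ℤ) * ρ + 16 < N := by exact_mod_cast hn
  have h := prop39_one_step (k := k) hk hρ (n := N) (m := N) (h := N / 2) (by omega)
    (by omega) (by omega) hN0 (by omega) p hp0 hp1
  rw [show (N : ℤ) + N = 2 * N by ring] at h
  have hsh := real_lr_shift (k := k) ((-(N : ℤ)), (0 : ℤ)) 0 (3 * N) 0 N p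
  dsimp only at hsh
  rw [show (0 : ℤ) + -(N : ℤ) = -N by ring, show (3 : ℤ) * N + -(N : ℤ) = 2 * N by ring] at hsh
  simp only [add_zero] at hsh
  rw [hsh] at h
  push_cast [hN] at h ⊢
  exact h

/-- **The closing step of Thm 3.14, general form**: if `c ≤ f_p(2Ln, Ln)` for all `n ≥ n₀` (`L ≥ 1`,
`n₀ > 8ρ+16`, `0 < c`), then for EVERY `m ≥ 1`,
`min (((1-√(1-c))c)²/(K₁²K₂)) (p^{2L·max(n₀,2)}) ≤ f_p(2m, m)`.  (For `m ≥ L·max(n₀,2)`, `n = ⌊m/L⌋`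
has `Ln ≤ m` and `2m ≤ 3Ln`, so `f(2m,m) ≥ f(3Ln, Ln)`; smaller `m` by `pow_le_real_lr`.)
[cite: NewmanTassionWu2017, Theorem 3.14 (end of proof, (3.54))] -/
theorem hardWay_of_f2L_L (hk : 1 ≤ k) {ρ : ℕ} (hρ : 4 ≤ ρ) (p : unitInterval) (hp0 : 0 < (p : ℝ))
    (hp1 : (p : ℝ) < 1) {c : ℝ} (hc : 0 < c) {L n₀ : ℕ} (hL : 1 ≤ L) (hn₀ : 8 * ρ + 16 < n₀)
    (h : ∀ n : ℕ, n₀ ≤ n → c ≤ (bondPercolation (slabGraph 3 k) p).real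
      (slabConn k (boxR 0 (2 * (L * n)) 0 (L * n)) {z | z.1 = 0} {z | z.1 = 2 * (L * n)})) :
    ∀ m : ℕ, 1 ≤ m →
      min (((1 - Real.sqrt (1 - c)) * c) ^ 2 /
          ((1 + (2 / min (p : ℝ) (1 - p)) ^ (3 * ((5 * k + 4) * (2 * (6 * ρ + 4) + 1) ^ 2))) ^ 2 *
            (1 + (2 / min (p : ℝ) (1 - p)) ^ (3 * ((5 * k + 4) * (2 * (2 * (3 * ρ + 3)) + 1) ^ 2)))))
        ((p : ℝ) ^ (2 * (L * max n₀ 2))) ≤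
      (bondPercolation (slabGraph 3 k) p).real (slabConn k (boxR 0 (2 * m) 0 m) {z | z.1 = 0} {z | z.1 = 2 * m}) := by
  set P := bondPercolation (slabGraph 3 k) p with hP
  set K : ℝ := (1 + (2 / min (p : ℝ) (1 - p)) ^ (3 * ((5 * k + 4) * (2 * (6 * ρ + 4) + 1) ^ 2))) ^ 2 *
      (1 + (2 / min (p : ℝ) (1 - p)) ^ (3 * ((5 * k + 4) * (2 * (2 * (3 * ρ + 3)) + 1) ^ 2))) with hK
  have hKpos : 0 < K := by positivity
  clear_value K
  intro m hm
  set T := max n₀ 2 with hT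
  by_cases hsmall : m < L * T
  · refine (min_le_right _ _).trans ?_
    have h1 := pow_le_real_lr (k := k) (2 * m) m p
    push_cast at h1
    refine le_trans ?_ h1
    exact pow_le_pow_of_le_one p.2.1 p.2.2 (by omega)
  · push Not at hsmall
    refine (min_le_left _ _).trans ?_
    set n := m / L with hn
    have hL0 : 0 < L := by omega
    have hnL : L * n ≤ m := by rw [hn, mul_comm]; exact Nat.div_mul_le_self m L
    have hmlt : m < L * n + L := by
      have := Nat.lt_div_mul_add (a := m) hL0
      rw [hn]; linarith
    have hnT : T ≤ n := by
      rw [hn, Nat.le_div_iff_mul_le hL0]; linarith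
    have hn2 : 2 ≤ n := le_trans (le_max_right _ _) hnT
    have hn₀n : n₀ ≤ n := le_trans (le_max_left _ _) hnT
    have h2m : 2 * m ≤ 3 * (L * n) := by nlinarith
    have hLn : 8 * ρ + 16 < L * n := by
      calc 8 * ρ + 16 < n₀ := hn₀
        _ ≤ n := hn₀n
        _ = 1 * n := (one_mul n).symm
        _ ≤ L * n := Nat.mul_le_mul_right n hL
    have hc' := h n hn₀n
    have hstep := real_lr_3L_ge hk hρ hLn p hp0 hp1
    rw [← hK] at hstep
    have hmono : (bondPercolation (slabGraph 3 k) p).real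
          (slabConn k (boxR 0 (3 * (L * n)) 0 (L * n)) {z | z.1 = 0} {z | z.1 = 3 * (L * n)}) ≤
        (bondPercolation (slabGraph 3 k) p).real (slabConn k (boxR 0 (2 * m) 0 m) {z | z.1 = 0} {z | z.1 = 2 * m}) := by
      have h1' : ((L * n : ℕ) : ℤ) ≤ m := by exact_mod_cast hnL
      have h2' : (2 : ℤ) * m ≤ 3 * ((L * n : ℕ) : ℤ) := by exact_mod_cast h2m
      push_cast at h1' h2' ⊢
      calc (bondPercolation (slabGraph 3 k) p).real
            (slabConn k (boxR 0 (3 * ((L : ℤ) * n)) 0 ((L : ℤ) * n)) {z | z.1 = 0} {z | z.1 = 3 * ((L : ℤ) * n)})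
          ≤ (bondPercolation (slabGraph 3 k) p).real
              (slabConn k (boxR 0 (2 * m) 0 ((L : ℤ) * n)) {z | z.1 = 0} {z | z.1 = 2 * m}) :=
            real_lr_wider_le (k := k) (a := 0) (b := 2 * m) (b' := 3 * ((L : ℤ) * n)) (c := 0) (d := (L : ℤ) * n)
              (by positivity) h2' p
        _ ≤ _ := real_lr_le_taller (k := k) (a := 0) (b := 2 * m) (c := 0) (d := (L : ℤ) * n) (c' := 0) (d' := m)
              le_rfl h1' p
    set f := P.real (slabConn k (boxR 0 (2 * ((L : ℤ) * n)) 0 ((L : ℤ) * n)) {z : ℤ × ℤ | z.1 = 0}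
      {z | z.1 = 2 * ((L : ℤ) * n)}) with hf
    have hf1 : f ≤ 1 := measureReal_le_one
    have hsq : 1 - Real.sqrt (1 - c) ≤ 1 - Real.sqrt (1 - f) := by
      have := Real.sqrt_le_sqrt (show 1 - f ≤ 1 - c by linarith)
      linarith
    have hs0 : 0 ≤ 1 - Real.sqrt (1 - c) := by
      have h1 : Real.sqrt (1 - c) ≤ Real.sqrt 1 := Real.sqrt_le_sqrt (by linarith)
      rw [Real.sqrt_one] at h1
      linarith
    have hprod : (1 - Real.sqrt (1 - c)) * c ≤ (1 - Real.sqrt (1 - f)) * f :=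
      mul_le_mul hsq hc' hc.le (hs0.trans hsq)
    have hsq2 : ((1 - Real.sqrt (1 - c)) * c) ^ 2 ≤ ((1 - Real.sqrt (1 - f)) * f) ^ 2 :=
      pow_le_pow_left₀ (mul_nonneg hs0 hc.le) hprod 2
    rw [div_le_iff₀ hKpos]
    calc ((1 - Real.sqrt (1 - c)) * c) ^ 2 ≤ ((1 - Real.sqrt (1 - f)) * f) ^ 2 := hsq2
      _ ≤ K * (bondPercolation (slabGraph 3 k) p).real
          (slabConn k (boxR 0 (3 * ((L : ℤ) * n)) 0 ((L : ℤ) * n)) {z | z.1 = 0} {z | z.1 = 3 * ((L : ℤ) * n)}) := hstep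
      _ ≤ K * P.real (slabConn k (boxR 0 (2 * m) 0 m) {z | z.1 = 0} {z | z.1 = 2 * m}) :=
          mul_le_mul_of_nonneg_left hmono hKpos.le
      _ = _ := by ring

/-! ## §5 The Case-3 endgame: from `f(14n, 13n) ≥ c₇` to `inf_m f(2m,m) > 0` -/

/-- **NTW 2017, Thm 3.14, end of Case 3 + closing step**: if `c ≤ f_p(14n, 13n)` for every `n ≥ n₀`
(`n₀ > 8ρ+16`, `0 < c`), then `inf_{m ≥ 1} f_p(2m, m) > 0` — twelve steps of Prop. 3.9 (1) at height
`13n` (`real_lr_item1_iter`: `f(26n,13n) ≥ a₁₂`) and the general closing step `hardWay_of_f2L_L` with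
`L = 13`. [cite: NewmanTassionWu2017, §3.5 (Case 3: "(3.52)… f(28n,13n) ≥ c₈ := h₂^{14}(c₇)" and (3.54))] -/
theorem hardWay_of_f14_13 (hk : 1 ≤ k) {ρ : ℕ} (hρ : 4 ≤ ρ) (p : unitInterval) (hp0 : 0 < (p : ℝ))
    (hp1 : (p : ℝ) < 1) {c : ℝ} (hc : 0 < c) {n₀ : ℕ} (hn₀ : 8 * ρ + 16 < n₀)
    (h : ∀ n : ℕ, n₀ ≤ n → c ≤ (bondPercolation (slabGraph 3 k) p).real
      (slabConn k (boxR 0 (14 * n) 0 (13 * n)) {z | z.1 = 0} {z | z.1 = 14 * n})) :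
    ∃ c' : ℝ, 0 < c' ∧ ∀ m : ℕ, 1 ≤ m → c' ≤ (bondPercolation (slabGraph 3 k) p).real
      (slabConn k (boxR 0 (2 * m) 0 m) {z | z.1 = 0} {z | z.1 = 2 * m}) := by
  have hc1 : c ≤ 1 := (h n₀ le_rfl).trans measureReal_le_one
  obtain ⟨a, ha0, ha1, -, -, hiter⟩ := real_lr_item1_iter hk hρ p hp0 hp1 hc hc1
  -- `a₁₂ ≤ f(26n, 13n)` for `n ≥ n₀`
  have h26 : ∀ n : ℕ, n₀ ≤ n → a 12 ≤ (bondPercolation (slabGraph 3 k) p).real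
      (slabConn k (boxR 0 (2 * (13 * n)) 0 (13 * n)) {z | z.1 = 0} {z | z.1 = 2 * (13 * n)}) := by
    intro n hn
    have hN : 8 * ρ + 16 < 13 * n := by omega
    have key := hiter (13 * n) n hN (by omega) 12 (by
      have := h n hn
      push_cast
      rw [show (13 : ℤ) * n + n = 14 * n by ring]
      exact this)
    have e : ((13 * n : ℕ) : ℤ) + (((12 : ℕ) : ℤ) + 1) * (n : ℤ) = 2 * (13 * (n : ℤ)) := by push_cast; ring
    rw [e] at key
    push_cast at key ⊢
    exact key
  obtain hmain := hardWay_of_f2L_L hk hρ p hp0 hp1 (ha0 12) (L := 13) (n₀ := n₀) (by norm_num) hn₀ h26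
  exact ⟨_, lt_min (by
    have hs : 0 < 1 - Real.sqrt (1 - a 12) := by
      have h1 : Real.sqrt (1 - a 12) < Real.sqrt 1 :=
        Real.sqrt_lt_sqrt (by linarith [ha1 12]) (by linarith [ha0 12])
      rw [Real.sqrt_one] at h1; linarith
    exact div_pos (pow_pos (mul_pos hs (ha0 12)) 2) (by positivity)) (by positivity), hmain⟩

end NTW17

end Literature.Probability.Percolation
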